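import Mathlib
import Summits.ResolutionOfSingularities.ResolutionOfSingularities.Theorems.HomologicalConductorPersistenceCyclicQuotientAllCharFree
import HarnessLib

/-!
# Rung S-2 `PersistenceSurface` (stmt-ResolutionOfSingularities-19970), stub C1 (`Sat₄`) — the SUMMAND DATA of the
# cyclic-quotient `Sat₄` theorem, EXPOSED (char-free)

[OURS · cell decomp-res · rung S-2; seat leafhand-res-homologicalconduct-15 gen 0]  Nothing here is a statement of the
manuscript under review (Hironaka 2017); AI-written, weaker than expert review.  DEF-FREE.

`…CyclicQuotientAllCharFree.cohomologyAnnihilator_cyclicQuotient_of_chain_charFree` builds, INSIDE its proof, the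
summand data fed to the abstract certificate `cohomologyAnnihilator_eq_of_summandData`: the weight pieces `M_a`
(`a ∈ ZMod n`) splitting `V = k[u,v]|_U`, their staircase first syzygies `K_a`, Wunram's law («`K_a ∈ add` of the
cospecial pieces `⊕_t M_{−i_{t+1}}` and `U`»), Ω-stability (numeration lemma), and the Herzog cover of the second
syzygies by `V`.  The level-exact completion transport (`…PersistenceSummandDataBaseChange`,
`…CompleteHerzogTransfer`, `…LocalHerzogTransfer`, this seat) consumes exactly this data; this file re-runs the proof
VERBATIM and RETURNS the data instead of the conclusion.

* `exists_summandData_cyclicQuotient_of_chain_charFree` — the data, for every field `k`, `gcd(q,n) = 1` forced by the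
  chain, `U = k[u,v]^{(n;1,q)}` the degree-`0` subalgebra.

References: as in `…CyclicQuotientAllCharFree` (Auslander 1986 / Herzog 1978 mechanism; Wunram 1988; Iyengar–Takahashi
2016 [`IyengarTakahashi2014`] vocabulary) — tree lemmas only.
-/

-- single-problem summit: the doubled namespace component `ResolutionOfSingularities` is forced
set_option linter.dupNamespace false

noncomputable section

open CategoryTheory Literature.RingTheory.CohomologyAnnihilator MvPolynomial
open Summit.ResolutionOfSingularities.ResolutionOfSingularities.Theorems.NoZeno.SandwichCluster
open Summit.ResolutionOfSingularities.ResolutionOfSingularities.Theorems.HomologicalConductor.PersistenceAddCoverFamily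
open Summit.ResolutionOfSingularities.ResolutionOfSingularities.Theorems.HomologicalConductor.PersistenceCyclicQuotientCharFree
open Summit.ResolutionOfSingularities.ResolutionOfSingularities.Theorems.HomologicalConductor.PersistenceCyclicQuotientGradedPieces
open Summit.ResolutionOfSingularities.ResolutionOfSingularities.Theorems.HomologicalConductor.PersistenceCyclicQuotientGradedStairCover
open Summit.ResolutionOfSingularities.ResolutionOfSingularities.Theorems.HomologicalConductor.PersistenceCyclicQuotientGradedStaircase
open Summit.ResolutionOfSingularities.ResolutionOfSingularities.Theorems.HomologicalConductor.PersistenceCyclicQuotientOneModQ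
  (natCast_val_add_mul_self val_sub_natCast_eq val_neg_natCast)
open Summit.ResolutionOfSingularities.ResolutionOfSingularities.Theorems.HomologicalConductor.PersistenceCyclicQuotientNumeration

universe u

namespace Summit.ResolutionOfSingularities.ResolutionOfSingularities.Theorems.HomologicalConductor.PersistenceCyclicQuotientSummandData

variable {k : Type u} [Field k] {n : ℕ} [NeZero n]
variable {q : ℕ} (U : Subalgebra k (MvPolynomial (Fin 2) k))
variable (hU : ∀ p, p ∈ U ↔ weightedHomogeneousComponent (![1, (q : ZMod n)] : Fin 2 → ZMod n) 0 p = p)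

set_option maxHeartbeats 1600000 in
set_option synthInstance.maxHeartbeats 400000 in
include hU in
/-- **THE SUMMAND DATA OF THE CYCLIC-QUOTIENT `Sat₄` THEOREM, EXPOSED.**  For the Hirzebruch–Jung chain `(e, i, b)` of
`n/q` and `U = k[u,v]^{(n;1,q)}` (char-free dictionary, `k` any field): weight pieces `M_a` (with their membership
criterion), modules `M'_a = M_a`, first syzygies `K_a`, the splitting `k[u,v]|_U ≅ Π_a M'_a`, the cospecial test family
`ψ t = −i_{t+1}` (`t : Fin e`) with finitely generated pieces, Wunram's law `K_a ∈ add ((Π_t M'_{ψ t}) × U)`,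
Ω-stability (every `M'_{ψ t}` a retract of some `K_{ψ s}`), and Herzog's cover (every second syzygy over `U` is a retract of
a power of `k[u,v]|_U`).  (Budgets raised locally as in the original.) [OURS · cell decomp-res] -/
theorem exists_summandData_cyclicQuotient_of_chain_charFree {e : ℕ} {i b : ℕ → ℕ} (hi0 : i 0 = n) (hi1 : i 1 = q)
    (hie : i e = 1) (hie1 : i (e + 1) = 0)
    (hrec : ∀ s, 1 ≤ s → s ≤ e → i (s - 1) + i (s + 1) = b s * i s) (hb : ∀ s, 1 ≤ s → s ≤ e → 2 ≤ b s) :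
    ∃ M : ZMod n → Submodule U ((restrictScalarsFunctor U (MvPolynomial (Fin 2) k)).obj
        (ModuleCat.of (MvPolynomial (Fin 2) k) (MvPolynomial (Fin 2) k))),
      (∀ (a : ZMod n) (p : MvPolynomial (Fin 2) k),
        (show ((restrictScalarsFunctor U (MvPolynomial (Fin 2) k)).obj
          (ModuleCat.of (MvPolynomial (Fin 2) k) (MvPolynomial (Fin 2) k))) from p) ∈ M a ↔
        weightedHomogeneousComponent (![1, (q : ZMod n)] : Fin 2 → ZMod n) a p = p) ∧
      ∃ (M' K : ZMod n → ModuleCat.{u} U)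
        (_ : (restrictScalarsFunctor U (MvPolynomial (Fin 2) k)).obj
          (ModuleCat.of (MvPolynomial (Fin 2) k) (MvPolynomial (Fin 2) k)) ≅ ModuleCat.of U (Π a, M' a))
        (ψ : Fin e → ZMod n) (_ : ∀ t, Module.Finite U (M' (ψ t))),
        (∀ a, M' a = @ModuleCat.of U _ (M a) _ (M a).module) ∧
        (∀ t : Fin e, ψ t = -((i (t.val + 1) : ℕ) : ZMod n)) ∧
        (∀ a, IsSyzygy 1 (M' a) (K a)) ∧
        (∀ a, IsRetractOfPower (ModuleCat.of U ((Π t, M' (ψ t)) × U)) (K a)) ∧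
        (∀ t, ∃ (s : Fin e) (ι : M' (ψ t) ⟶ K (ψ s)) (r : K (ψ s) ⟶ M' (ψ t)), ι ≫ r = 𝟙 (M' (ψ t))) ∧
        (∀ (N L : ModuleCat.{u} U), Module.Finite U N → IsSyzygy 2 N L →
          IsRetractOfPower ((restrictScalarsFunctor U (MvPolynomial (Fin 2) k)).obj
            (ModuleCat.of (MvPolynomial (Fin 2) k) (MvPolynomial (Fin 2) k))) L) := by
  classical
  have h2 := two_mul_le_of_chain hrec hb
  have hilt := lt_of_chain hie hie1 h2
  have hile := le_of_chain hie hie1 h2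
  obtain ⟨j, hj0, hj1, hjrec, hjmono⟩ := exists_jSeries hb
  -- `q` is coprime to `n` (from `q · j e ≡ i e = 1`, or `n = 1` for the empty chain)
  have hcop : Nat.Coprime q n := by
    rcases Nat.eq_zero_or_pos e with he0 | he1
    · subst he0
      rw [← hi0, hie]
      exact Nat.coprime_one_right q
    · obtain ⟨kk, hkk⟩ := exists_kSeries hrec hb hj0 hj1 hjrec e he1 (by omega)
      rw [hie, hi0, hi1] at hkk
      rw [Nat.coprime_iff_gcd_eq_one]
      have hd1 : Nat.gcd q n ∣ q * j e := Dvd.dvd.mul_right (Nat.gcd_dvd_left _ _) _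
      have hd2 : Nat.gcd q n ∣ n * kk := Dvd.dvd.mul_right (Nat.gcd_dvd_right _ _) _
      rw [← hkk] at hd1
      exact Nat.dvd_one.mp ((Nat.dvd_add_right hd2).mp (by rwa [Nat.add_comm] at hd1))
  obtain ⟨M, hM, ⟨eM⟩⟩ := exists_graded_splitting q U hU
  -- the greedy staircase of every class
  have hstair := fun a : ZMod n =>
    exists_greedyStaircase hie hie1 hrec hb hj0 hj1 hjrec hjmono a.val (by rw [hi0]; exact ZMod.val_lt a)
  choose μ c pos σ hc0 hpos0 hanti hmono hcμ hafter hdrop hclass hcover using hstair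
  -- drop classes
  let d : ZMod n → ℕ → ZMod n := fun a t => -((i (σ a t) : ℕ) : ZMod n)
  -- the class of every generator
  have hcl : ∀ a s, ((c a s + q * pos a s : ℕ) : ZMod n) = a := by
    intro a s
    obtain ⟨K, hK⟩ := hclass a s
    rw [hi1, hi0] at hK
    rw [hK, Nat.cast_add, Nat.cast_mul, ZMod.natCast_self, zero_mul, add_zero, ZMod.natCast_zmod_val]
  -- the drop classes are the syzygy classes
  have hψ : ∀ a t, t < μ a → d a t = a - ((c a t + q * pos a (t + 1) : ℕ) : ZMod n) := by
    intro a t ht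
    obtain ⟨-, -, -, -, -, -, K, hK⟩ := hdrop a t ht
    rw [hi1, hi0] at hK
    dsimp only [d]
    rw [hK, Nat.cast_add, Nat.cast_add, Nat.cast_mul, ZMod.natCast_self, zero_mul, add_zero, ZMod.natCast_zmod_val]
    ring
  -- `q J ≡ a` for `J = pos a (μ a)`
  have hJ : ∀ a, ((q * pos a (μ a) : ℕ) : ZMod n) = a := by
    intro a
    have h := hcl a (μ a)
    rwa [hcμ a, zero_add] at h
  -- the cover property in `ZMod` form
  have hcov : ∀ a x, x ≤ pos a (μ a) → ∃ s, s ≤ μ a ∧ pos a s ≤ x ∧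
      c a s ≤ ((a - ((q * x : ℕ) : ZMod n) : ZMod n)).val := by
    intro a x hx
    obtain ⟨t, htμ, hpt, H⟩ := hcover a x hx
    refine ⟨t, htμ, hpt, H _ (by rw [hi0]; exact ZMod.val_lt _) ?_⟩
    rw [hi1, hi0]
    refine (ZMod.natCast_eq_natCast_iff _ _ _).mp ?_
    have h := hcl a t
    rw [Nat.cast_add, Nat.cast_mul] at h
    rw [Nat.cast_add, ZMod.natCast_zmod_val, Nat.cast_mul, Nat.cast_mul, Nat.cast_sub hpt]
    linear_combination (-1 : ZMod n) * h
  -- the staircase resolutions `Ω M_a ≅ Π_{t < μ a} M (d a t)`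
  let M' : ZMod n → ModuleCat.{u} U := fun a => @ModuleCat.of U _ (M a) _ (M a).module
  let K : ZMod n → ModuleCat.{u} U := fun a => ModuleCat.of U (Π t : Fin (μ a), M (d a t))
  have hK : ∀ a, IsSyzygy 1 (M' a) (K a) := by
    intro a
    refine isSyzygy_one_staircase_graded q U hU M hM a (μ a) (c a) (pos a) (hanti a) (hmono a) (hcl a)
      (fun t : Fin (μ a) => d a t) (fun t => hψ a t t.isLt) ?_
    exact (piece_eq_span_of_cover q U hU M hM a (μ a) (pos a (μ a)) (c a) (pos a) (hcl a) (hJ a) (hcov a)).le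
  -- the certificate data: the cospecial family `{M_{−i_1}, …, M_{−i_e}}`
  let ψ' : Fin e → ZMod n := fun t => -((i (t.val + 1) : ℕ) : ZMod n)
  have hdψ : ∀ a t, t < μ a → ∃ s : Fin e, d a t = ψ' s := by
    intro a t ht
    obtain ⟨hs1, hse, -⟩ := hdrop a t ht
    refine ⟨⟨σ a t - 1, by omega⟩, ?_⟩
    simp only [d, ψ', Nat.sub_add_cancel hs1]
  haveI hfin : ∀ t, Module.Finite U (M' (ψ' t)) := fun t => finite_pieces q U hU M hM _
  have hKD : ∀ a, IsRetractOfPower (ModuleCat.of U ((Π t, M' (ψ' t)) × U)) (K a) := by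
    intro a
    refine IsRetractOfPower.piFamily (fun t : Fin (μ a) => M' (d a t)) fun t => ?_
    obtain ⟨s, heq⟩ := hdψ a t t.isLt
    exact (isRetractOfPower_fst (ModuleCat.of U (Π t, M' (ψ' t))) (ModuleCat.of U U)).of_isRetractOfPower_gen
      ((isRetractOfPower_eval (fun t : Fin e => M' (ψ' t)) s).of_iso
        (LinearEquiv.toModuleIso (LinearEquiv.ofEq _ _ (by rw [heq]))))
  have hD : ∀ t, ∃ (s : Fin e) (ι : M' (ψ' t) ⟶ K (ψ' s)) (r : K (ψ' s) ⟶ M' (ψ' t)),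
      ι ≫ r = 𝟙 (M' (ψ' t)) := by
    -- the NUMERATION LEMMA picks the source; the greedy staircase of the source class hits the target
    have hsrc : ∀ t : Fin e, ∃ (s : Fin e) (p : Fin (μ (ψ' s))), d (ψ' s) p = ψ' t := by
      intro t
      obtain ⟨w, hw1, hwe, hnum⟩ := exists_source_of_target hie hie1 hrec hb (t.val + 1) (by omega) t.isLt
      let s : Fin e := ⟨w - 1, by omega⟩
      have hψs : ψ' s = -((i w : ℕ) : ZMod n) := by
        simp only [ψ', s, Nat.sub_add_cancel hw1]
      have hiw1 : 1 ≤ i w := one_le_of_chain hie hie1 h2 w hwe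
      have hiwn : i w ≤ n := by rw [← hi0]; exact hile 0 w (Nat.zero_le _) (by omega)
      have hval : (ψ' s).val = n - i w := by rw [hψs]; exact val_neg_natCast hiw1 hiwn
      -- the greedy remainders of the source class `n - i w`
      let τ : ℕ → ℕ := fun r => Nat.rec (n - i w) (fun r v => v % i (r + 1)) r
      have hτ0 : τ 0 = n - i w := rfl
      have hτs : ∀ r, 1 ≤ r → r ≤ e → τ r = τ (r - 1) % i r := by
        intro r hr1 _
        obtain ⟨r', rfl⟩ : ∃ r', r = r' + 1 := ⟨r - 1, by omega⟩
        rw [Nat.add_sub_cancel]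
      have hdigit : i (t.val + 1) ≤ τ t.val := by
        have := hnum τ (by rw [hτ0, hi0]) hτs
        rwa [Nat.add_sub_cancel] at this
      obtain ⟨p, hpμ, hσp⟩ := exists_greedy_hit hie hie1 h2 (hcμ (ψ' s))
        (fun t' ht' => by
          obtain ⟨h1, h3, h4, h5, h6, -⟩ := hdrop (ψ' s) t' ht'
          exact ⟨h1, h3, h4, h5, h6⟩)
        (by rw [hc0, hi0]; exact ZMod.val_lt _) τ (by rw [hτ0, hc0, hval]) hτs t.val (by omega) hdigit
      refine ⟨s, ⟨p, hpμ⟩, ?_⟩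
      change -((i (σ (ψ' s) p) : ℕ) : ZMod n) = ψ' t
      rw [hσp]
    intro t
    obtain ⟨s, p, hp⟩ := hsrc t
    let E : M (d (ψ' s) p) ≃ₗ[U] M (ψ' t) := LinearEquiv.ofEq _ _ (by rw [hp])
    refine ⟨s,
      @ModuleCat.ofHom U _ (M (ψ' t)) (Π t' : Fin (μ (ψ' s)), M (d (ψ' s) t'))
        _ (M (ψ' t)).module _ _
        ((LinearMap.single U (fun t' : Fin (μ (ψ' s)) => M (d (ψ' s) t')) p) ∘ₗ E.symm.toLinearMap),
      @ModuleCat.ofHom U _ (Π t' : Fin (μ (ψ' s)), M (d (ψ' s) t')) (M (ψ' t))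
        _ _ _ (M (ψ' t)).module (E.toLinearMap ∘ₗ LinearMap.proj p), ?_⟩
    apply ModuleCat.hom_ext
    refine LinearMap.ext fun x => ?_
    change E ((Pi.single p (E.symm x) : Π t' : Fin (μ (ψ' s)), M (d (ψ' s) t')) p) = x
    rw [Pi.single_eq_same, LinearEquiv.apply_symm_apply]
  haveI := isNoetherianRing_degreeZero (k := k) (n := n) q U hU
  have hcov2 := isRetractOfPower_of_isSyzygy_two_charFree (k := k) (n := n) hcop U hU
  exact ⟨M, hM, M', K, eM, ψ', hfin, fun a => rfl, fun t => rfl, hK, hKD, hD, hcov2⟩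

end Summit.ResolutionOfSingularities.ResolutionOfSingularities.Theorems.HomologicalConductor.PersistenceCyclicQuotientSummandData

end
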